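import Summits.ResolutionOfSingularities.ResolutionOfSingularities.Theorems.EquisingularLiftEquisingularLiftNatSpecimenQuarticDerivations
import Mathlib.RingTheory.RegularLocalRing.Polynomial
import HarnessLib

/-!
# [OURS · L1 W4.5(b)] T-ISO-1 algebra layer, I: the LINE STEP of the quartic specimen and its smooth affine charts

Helper for the research stub `stub_elnat_three_isolated_nonabs` of the crux `EquisingularLiftNat`
(stmt-ResolutionOfSingularities-20038; route `EquisingularLift`, chain w45b, CHAIN v7.1 §3 row
T-ISO-1 «downstairs charts p504547 (stub-4) → assembly»; also the downstairs ∃-discharge of the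
quartic instance of res-L1-w45b-lead-2's rungs T-Δ-ISO / T-ISO-0⁺). NOT a statement of any manuscript;
AI-written kernel lemma of the cell `res-hironaka` (weaker than expert review).

**The specimen** (T-ISO-1, lead-2): `H = V(x₀²x₃² + x₁⁴ + x₂⁴) ⊂ ℙ³_k`, `char k ≠ 2`, with the two
isolated singular points `z² + x⁴ + y⁴` (`[0:0:0:1]`, `[1:0:0:0]`). Downstairs resolution (by hand and
in the polynomial identities of `…NatSpecimenQuarticCharts.lean`, p504547): blow up the point; on the
`x`-chart of the point blow-up the strict transform is `g = y₂² + y₁²(1 + y₀⁴)` in the chart coordinates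
`(y₀, y₁, y₂) = (y/x, x, z/x)`, singular exactly along the LINE `ℓ = V(y₁, y₂)` of the exceptional
plane (an `A₁` double line — NOT isolated after the section); blow up `ℓ`: the two strict-transform
charts `t² + 1 + y₀⁴` (`t = y₂/y₁`) and `1 + s²(1 + y₀⁴)` (`s = y₁/y₂`) are smooth.

**This file = the LINE STEP as `IsRegularRing` statements in the blowup-algebra currency of R2**
(`…NatSpecimenWhitneyCubicAlgebra.lean`, p507017: centre `WhitneyCubic.cen = (y₁, y₂) ⊂ A = k[y₀,y₁,y₂]`,
chart rings `A[I/yᵢ]`), through the multi-derivation criterion of part 0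
(`…NatSpecimenQuarticDerivations.lean`), plus the affine charts of `H` off the two singular points:

* **`isRegularRing_lineChart₀`** — chart `b = y₁`: `g = y₁²·(t² + 1 + y₀⁴)`; at a prime `Q ∋ g″` the
  values `∂/∂y₀ ↦ 4y₀³`, `∂/∂t ↦ 2t` cannot both lie in `Q` (else `1 = g″ − t·t − y₀·y₀³ ∈ Q`);
* **`isRegularRing_lineChart₁`** — chart `b = y₂`: `g = y₂²·(1 + s²c)`, `c = 1 + y₀⁴`, `∂/∂s ↦ 2sc`,
  and `sc ∈ Q ∋ 1 + s²c` is impossible;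
* **`isRegularRing_quotient_smoothChart`** — the charts `x₁ = 1` / `x₂ = 1` of `H`: `q = a²c² + b⁴ + 1`,
  `q − (a/2)∂_a q − (b/4)∂_b q = 1`.

All under `IsUnit (2 : k)` (`char k ≠ 2`). The POINT STEP (`z`-chart of `Bl_P` regular; the `x`/`y`
charts `≅ A/(g)`) is part II (`…NatSpecimenQuarticPointStep.lean`). NOT here: the `Proj`-level forms
layer and the `ELNatAt` assembly (wait on R1-IN-CARRIER / the T-Δ-ISO frame, CHAIN v7.1 §3).

References: The Stacks Project, Tags 07PF, 0BIQ; Görtz–Wedhorn I, Prop. 13.96 (2) — through the cited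
tree files.
-/

set_option linter.dupNamespace false -- mandated namespace `Summit.<Summit>.<Problem>` of this single-conjunct summit

noncomputable section

open MvPolynomial IsLocalRing
open Literature.AlgebraicGeometry.Resolution
open Summit.ResolutionOfSingularities.ResolutionOfSingularities.Cruxes.EquisingularLiftNat.Sections

namespace Summit.ResolutionOfSingularities.ResolutionOfSingularities.Theorems.EquisingularLift.SpecimenQuartic

universe u

/-! ## The line step: `g = y₂² + y₁²(1 + y₀⁴)`, centre `(y₁, y₂)` -/

section LineStep

variable (k : Type) [Field k]

/-- The unit `2` of `k` is a unit in every `k`-algebra. [folklore] -/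
theorem isUnit_two_of {B : Type u} [CommRing B] [Algebra k B] (h2 : IsUnit (2 : k)) : IsUnit (2 : B) := by
  have h := h2.map (algebraMap k B)
  rwa [map_ofNat] at h

/-- **Line step, chart `b = y₁`** (`t = y₂/y₁`): `g = y₁²·(t² + 1 + y₀⁴)`; at a prime `Q ∋ g″ := t² + 1 + y₀⁴`
the derivations `∂/∂y₀ ↦ 4y₀³` and `∂/∂t ↦ 2t` cannot both land in `Q` (else `1 = g″ − t·t − y₀·y₀³ ∈ Q`,
using `2 ∈ kˣ`); so the chart ring `(A/(g))[Ī/ȳ₁]` of `Bl_ℓ V(g)` is regular.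
[OURS · T-ISO-1 algebra; folklore commutative algebra] -/
theorem isRegularRing_lineChart₀ (h2 : IsUnit (2 : k)) :
    IsRegularRing (blowupAlgebra ((Ideal.span (Set.range (WhitneyCubic.cen k))).map
      (Ideal.Quotient.mk (Ideal.span {(X 2 ^ 2 + X 1 ^ 2 * (1 + X 0 ^ 4) : MvPolynomial (Fin 3) k)})))
      (Ideal.Quotient.mk (Ideal.span {(X 2 ^ 2 + X 1 ^ 2 * (1 + X 0 ^ 4) : MvPolynomial (Fin 3) k)}) (WhitneyCubic.cen k 0))) := by
  -- `G″ = T₁² + C(1 + y₀⁴)`, `T₁ ↦ t = y₂/y₁`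
  refine isRegularRing_blowupAlgebra_quotient_of_derivations k 0 (n := 2)
    (X ⟨1, one_ne_zero⟩ ^ 2 + C (1 + X 0 ^ 4)) ?_ (m := Finsupp.single ⟨1, one_ne_zero⟩ 2) ?_ ?_
  · apply Subtype.ext
    rw [show (X 2 ^ 2 + X 1 ^ 2 * (1 + X 0 ^ 4) : MvPolynomial (Fin 3) k) =
      WhitneyCubic.cen k 1 ^ 2 + WhitneyCubic.cen k 0 ^ 2 * (1 + X 0 ^ 4) from rfl]
    simp only [map_add, map_mul, map_pow, map_one, blowupAlgebra.eval_C, blowupAlgebra.eval_X, Subalgebra.coe_mul,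
      Subalgebra.coe_pow, Subalgebra.coe_add, Subalgebra.coe_one, Subalgebra.coe_algebraMap, blowupAlgebra.coe_frac]
    have h := WhitneyCubic.algebraMap_mul_invSelf k 0
    linear_combination (-(algebraMap (MvPolynomial (Fin 3) k) (Localization.Away (WhitneyCubic.cen k 0)) (WhitneyCubic.cen k 1) ^ 2) *
      (algebraMap (MvPolynomial (Fin 3) k) (Localization.Away (WhitneyCubic.cen k 0)) (WhitneyCubic.cen k 0) *
        IsLocalization.Away.invSelf (WhitneyCubic.cen k 0) + 1)) * h
  · have hc : MvPolynomial.coeff (Finsupp.single (⟨1, one_ne_zero⟩ : {j : Fin 2 // j ≠ 0}) 2)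
        (X ⟨1, one_ne_zero⟩ ^ 2 + C (1 + X 0 ^ 4) : MvPolynomial {j : Fin 2 // j ≠ 0} (MvPolynomial (Fin 3) k)) = 1 := by
      classical
      rw [coeff_add, coeff_X_pow, if_pos rfl, coeff_C, if_neg]
      · ring
      · intro h
        have := congrArg (fun e : {j : Fin 2 // j ≠ 0} →₀ ℕ => e ⟨1, one_ne_zero⟩) h
        simp at this
    rw [hc]
    exact WhitneyCubic.one_not_mem k
  · intro Q hQ hGQ
    obtain ⟨D₀, hD₀, hD₀frac⟩ := exists_derivation_d0 k 0
    obtain ⟨Dt, hDt, hDt1⟩ := exists_derivation_chart₀_dt k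
    have h2B : IsUnit (2 : blowupAlgebra (Ideal.span (Set.range (WhitneyCubic.cen k))) (WhitneyCubic.cen k 0)) :=
      isUnit_two_of k h2
    -- values of the two derivations on the generators
    have ht0 : D₀ (blowupAlgebra.frac (WhitneyCubic.cen k) 0 1) = 0 := hD₀frac 1
    have hy0 : D₀ (algebraMap (MvPolynomial (Fin 3) k) _ (X 0)) = 1 := by
      rw [hD₀, pderiv_X_self, map_one]
    have hty : Dt (algebraMap (MvPolynomial (Fin 3) k) _ (X 0)) = 0 := by
      rw [hDt, Derivation.smul_apply, pderiv_X_of_ne (by decide : (0 : Fin 3) ≠ 2), smul_zero, map_zero]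
    -- the chart element `t² + 1 + y₀⁴`
    have hev : blowupAlgebra.eval (WhitneyCubic.cen k) 0 (X ⟨1, one_ne_zero⟩ ^ 2 + C (1 + X 0 ^ 4)) =
        blowupAlgebra.frac (WhitneyCubic.cen k) 0 1 ^ 2 + 1 +
          algebraMap (MvPolynomial (Fin 3) k) _ (X 0) ^ 4 := by
      rw [map_add, map_pow, blowupAlgebra.eval_X, blowupAlgebra.eval_C, map_add, map_one, map_pow]
      ring
    have hD₀val : D₀ (blowupAlgebra.frac (WhitneyCubic.cen k) 0 1 ^ 2 + 1 +
        algebraMap (MvPolynomial (Fin 3) k) _ (X 0) ^ 4) = 4 * algebraMap (MvPolynomial (Fin 3) k) _ (X 0) ^ 3 := by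
      have e1 : D₀ (blowupAlgebra.frac (WhitneyCubic.cen k) 0 1 ^ 2) = 0 := by
        rw [Derivation.leibniz_pow, ht0, smul_zero, smul_zero]
      have e2 : D₀ (algebraMap (MvPolynomial (Fin 3) k) _ (X 0) ^ 4) =
          4 * algebraMap (MvPolynomial (Fin 3) k) _ (X 0) ^ 3 := by
        rw [Derivation.leibniz_pow, hy0, show (4 - 1 : ℕ) = 3 from rfl]
        simp only [smul_eq_mul, mul_one, nsmul_eq_mul, Nat.cast_ofNat]
      rw [map_add, map_add, e1, Derivation.map_one_eq_zero, e2, zero_add, zero_add]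
    have hDtval : Dt (blowupAlgebra.frac (WhitneyCubic.cen k) 0 1 ^ 2 + 1 +
        algebraMap (MvPolynomial (Fin 3) k) _ (X 0) ^ 4) = 2 * blowupAlgebra.frac (WhitneyCubic.cen k) 0 1 := by
      have e1 : Dt (blowupAlgebra.frac (WhitneyCubic.cen k) 0 1 ^ 2) = 2 * blowupAlgebra.frac (WhitneyCubic.cen k) 0 1 := by
        rw [Derivation.leibniz_pow, hDt1, show (2 - 1 : ℕ) = 1 from rfl, pow_one]
        simp only [smul_eq_mul, mul_one, nsmul_eq_mul, Nat.cast_ofNat]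
      have e2 : Dt (algebraMap (MvPolynomial (Fin 3) k) _ (X 0) ^ 4) = 0 := by
        rw [Derivation.leibniz_pow, hty, smul_zero, smul_zero]
      rw [map_add, map_add, e1, Derivation.map_one_eq_zero, e2, add_zero, add_zero]
    rw [hev] at hGQ ⊢
    by_contra hnone
    simp only [not_exists, not_not] at hnone
    have hA : 4 * algebraMap (MvPolynomial (Fin 3) k) _ (X 0) ^ 3 ∈ Q := by rw [← hD₀val]; exact hnone D₀
    have hB' : 2 * blowupAlgebra.frac (WhitneyCubic.cen k) 0 1 ∈ Q := by rw [← hDtval]; exact hnone Dt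
    have hy0Q : algebraMap (MvPolynomial (Fin 3) k) _ (X 0) ∈ Q :=
      hQ.mem_of_pow_mem 3 (mem_of_four_mul_mem hQ h2B hA)
    have htQ : blowupAlgebra.frac (WhitneyCubic.cen k) 0 1 ∈ Q := mem_of_two_mul_mem hQ h2B hB'
    have h1 : (1 : blowupAlgebra (Ideal.span (Set.range (WhitneyCubic.cen k))) (WhitneyCubic.cen k 0)) =
        (blowupAlgebra.frac (WhitneyCubic.cen k) 0 1 ^ 2 + 1 + algebraMap (MvPolynomial (Fin 3) k) _ (X 0) ^ 4) -
          blowupAlgebra.frac (WhitneyCubic.cen k) 0 1 * blowupAlgebra.frac (WhitneyCubic.cen k) 0 1 -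
          algebraMap (MvPolynomial (Fin 3) k) _ (X 0) * algebraMap (MvPolynomial (Fin 3) k) _ (X 0) ^ 3 := by
      ring
    have h1Q : (1 : blowupAlgebra (Ideal.span (Set.range (WhitneyCubic.cen k))) (WhitneyCubic.cen k 0)) ∈ Q := by
      rw [h1]
      exact Q.sub_mem (Q.sub_mem hGQ (Q.mul_mem_left _ htQ)) (Q.mul_mem_left _ (Q.pow_mem_of_mem hy0Q 3 (by norm_num)))
    exact hQ.ne_top ((Ideal.eq_top_iff_one _).mpr h1Q)

/-- **Line step, chart `b = y₂`** (`s = y₁/y₂`): `g = y₂²·(1 + s²(1 + y₀⁴))`; with `c = 1 + y₀⁴` and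
`g‴ = 1 + s²c` one has `∂/∂s (g‴) = 2sc`, and `2sc ∈ Q ∋ g‴` is impossible for a prime `Q` (`s ∈ Q` or
`c ∈ Q` gives `1 ∈ Q`); so `(A/(g))[Ī/ȳ₂]` is regular. [OURS · T-ISO-1 algebra; folklore] -/
theorem isRegularRing_lineChart₁ (h2 : IsUnit (2 : k)) :
    IsRegularRing (blowupAlgebra ((Ideal.span (Set.range (WhitneyCubic.cen k))).map
      (Ideal.Quotient.mk (Ideal.span {(X 2 ^ 2 + X 1 ^ 2 * (1 + X 0 ^ 4) : MvPolynomial (Fin 3) k)})))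
      (Ideal.Quotient.mk (Ideal.span {(X 2 ^ 2 + X 1 ^ 2 * (1 + X 0 ^ 4) : MvPolynomial (Fin 3) k)}) (WhitneyCubic.cen k 1))) := by
  -- `G‴ = 1 + T₀² · C(1 + y₀⁴)`, `T₀ ↦ s = y₁/y₂`
  refine isRegularRing_blowupAlgebra_quotient_of_derivations k 1 (n := 2)
    (1 + X ⟨0, zero_ne_one⟩ ^ 2 * C (1 + X 0 ^ 4)) ?_ (m := 0) ?_ ?_
  · apply Subtype.ext
    rw [show (X 2 ^ 2 + X 1 ^ 2 * (1 + X 0 ^ 4) : MvPolynomial (Fin 3) k) =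
      WhitneyCubic.cen k 1 ^ 2 + WhitneyCubic.cen k 0 ^ 2 * (1 + X 0 ^ 4) from rfl]
    simp only [map_add, map_mul, map_pow, map_one, blowupAlgebra.eval_C, blowupAlgebra.eval_X, Subalgebra.coe_mul,
      Subalgebra.coe_pow, Subalgebra.coe_add, Subalgebra.coe_one, Subalgebra.coe_algebraMap, blowupAlgebra.coe_frac]
    have h := WhitneyCubic.algebraMap_mul_invSelf k 1
    linear_combination (-(algebraMap (MvPolynomial (Fin 3) k) (Localization.Away (WhitneyCubic.cen k 1)) (WhitneyCubic.cen k 0) ^ 2) *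
      (1 + algebraMap (MvPolynomial (Fin 3) k) (Localization.Away (WhitneyCubic.cen k 1)) (X 0) ^ 4) *
      (algebraMap (MvPolynomial (Fin 3) k) (Localization.Away (WhitneyCubic.cen k 1)) (WhitneyCubic.cen k 1) *
        IsLocalization.Away.invSelf (WhitneyCubic.cen k 1) + 1)) * h
  · have hc : MvPolynomial.coeff (0 : {j : Fin 2 // j ≠ 1} →₀ ℕ)
        (1 + X ⟨0, zero_ne_one⟩ ^ 2 * C (1 + X 0 ^ 4) : MvPolynomial {j : Fin 2 // j ≠ 1} (MvPolynomial (Fin 3) k)) = 1 := by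
      classical
      rw [coeff_add, coeff_one, if_pos rfl, mul_comm, coeff_C_mul, coeff_X_pow, if_neg]
      · ring
      · intro h
        have := congrArg (fun e : {j : Fin 2 // j ≠ 1} →₀ ℕ => e ⟨0, zero_ne_one⟩) h
        simp at this
    rw [hc]
    exact WhitneyCubic.one_not_mem k
  · intro Q hQ hGQ
    obtain ⟨Ds, hDs, hDs1⟩ := exists_derivation_chart₁_ds k
    have h2B : IsUnit (2 : blowupAlgebra (Ideal.span (Set.range (WhitneyCubic.cen k))) (WhitneyCubic.cen k 1)) :=
      isUnit_two_of k h2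
    have hDsc : Ds (algebraMap (MvPolynomial (Fin 3) k) _ (1 + X 0 ^ 4)) = 0 := by
      have h0 : (pderiv 1 : Derivation k (MvPolynomial (Fin 3) k) _) (1 + X 0 ^ 4 : MvPolynomial (Fin 3) k) = 0 := by
        rw [map_add, Derivation.map_one_eq_zero, Derivation.leibniz_pow, pderiv_X_of_ne (by decide : (0 : Fin 3) ≠ 1),
          smul_zero, smul_zero, add_zero]
      rw [hDs, Derivation.smul_apply, h0, smul_zero, map_zero]
    have hev : blowupAlgebra.eval (WhitneyCubic.cen k) 1 (1 + X ⟨0, zero_ne_one⟩ ^ 2 * C (1 + X 0 ^ 4)) =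
        1 + blowupAlgebra.frac (WhitneyCubic.cen k) 1 0 ^ 2 * algebraMap (MvPolynomial (Fin 3) k) _ (1 + X 0 ^ 4) := by
      rw [map_add, map_one, map_mul, map_pow, blowupAlgebra.eval_X, blowupAlgebra.eval_C]
    have hDsval : Ds (1 + blowupAlgebra.frac (WhitneyCubic.cen k) 1 0 ^ 2 *
        algebraMap (MvPolynomial (Fin 3) k) _ (1 + X 0 ^ 4)) =
        2 * (blowupAlgebra.frac (WhitneyCubic.cen k) 1 0 * algebraMap (MvPolynomial (Fin 3) k) _ (1 + X 0 ^ 4)) := by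
      rw [map_add, Derivation.map_one_eq_zero, zero_add, Derivation.leibniz, Derivation.leibniz_pow, hDs1, hDsc,
        smul_zero, zero_add, show (2 - 1 : ℕ) = 1 from rfl, pow_one]
      simp only [smul_eq_mul, mul_one, nsmul_eq_mul, Nat.cast_ofNat]
      ring
    rw [hev] at hGQ ⊢
    refine ⟨Ds, fun hmem => ?_⟩
    rw [hDsval] at hmem
    have hsc : blowupAlgebra.frac (WhitneyCubic.cen k) 1 0 * algebraMap (MvPolynomial (Fin 3) k) _ (1 + X 0 ^ 4) ∈ Q :=
      mem_of_two_mul_mem hQ h2B hmem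
    rcases hQ.mem_or_mem hsc with hsQ | hcQ
    · have h1 : (1 : blowupAlgebra (Ideal.span (Set.range (WhitneyCubic.cen k))) (WhitneyCubic.cen k 1)) =
          (1 + blowupAlgebra.frac (WhitneyCubic.cen k) 1 0 ^ 2 * algebraMap (MvPolynomial (Fin 3) k) _ (1 + X 0 ^ 4)) -
            blowupAlgebra.frac (WhitneyCubic.cen k) 1 0 *
              (blowupAlgebra.frac (WhitneyCubic.cen k) 1 0 * algebraMap (MvPolynomial (Fin 3) k) _ (1 + X 0 ^ 4)) := by
        ring
      have h1Q : (1 : blowupAlgebra (Ideal.span (Set.range (WhitneyCubic.cen k))) (WhitneyCubic.cen k 1)) ∈ Q := by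
        rw [h1]; exact Q.sub_mem hGQ (Q.mul_mem_left _ hsc)
      exact hQ.ne_top ((Ideal.eq_top_iff_one _).mpr h1Q)
    · have h1 : (1 : blowupAlgebra (Ideal.span (Set.range (WhitneyCubic.cen k))) (WhitneyCubic.cen k 1)) =
          (1 + blowupAlgebra.frac (WhitneyCubic.cen k) 1 0 ^ 2 * algebraMap (MvPolynomial (Fin 3) k) _ (1 + X 0 ^ 4)) -
            blowupAlgebra.frac (WhitneyCubic.cen k) 1 0 ^ 2 * algebraMap (MvPolynomial (Fin 3) k) _ (1 + X 0 ^ 4) := by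
        ring
      have h1Q : (1 : blowupAlgebra (Ideal.span (Set.range (WhitneyCubic.cen k))) (WhitneyCubic.cen k 1)) ∈ Q := by
        rw [h1]; exact Q.sub_mem hGQ (Q.mul_mem_left _ hcQ)
      exact hQ.ne_top ((Ideal.eq_top_iff_one _).mpr h1Q)

end LineStep

/-! ## The affine charts of `H` off the two singular points -/

section SmoothCharts

variable (k : Type) [Field k]

/-- **The charts `x₁ = 1` and `x₂ = 1` of `H = V(x₀²x₃² + x₁⁴ + x₂⁴)` are regular**: both are
`V(q)`, `q = a²c² + b⁴ + 1 ∈ k[a, b, c]`, and at a prime `Q ∋ q` the partials `∂_a q = 2ac²`,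
`∂_b q = 4b³` cannot both lie in `Q` (else `a²c², b⁴ ∈ Q` and `1 = q − a²c² − b⁴ ∈ Q`), `char k ≠ 2`.
[OURS · T-ISO-1 algebra; folklore] -/
theorem isRegularRing_quotient_smoothChart (h2 : IsUnit (2 : k)) :
    IsRegularRing (MvPolynomial (Fin 3) k ⧸
      Ideal.span {(X 0 ^ 2 * X 2 ^ 2 + X 1 ^ 4 + 1 : MvPolynomial (Fin 3) k)}) := by
  refine isRegularRing_quotient_of_derivations (S₀ := k) _ fun Q hQ hqQ => ?_
  have h2A : IsUnit (2 : MvPolynomial (Fin 3) k) := isUnit_two_of k h2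
  by_contra hnone
  simp only [not_exists, not_not] at hnone
  have ha := hnone (pderiv 0)
  have hb := hnone (pderiv 1)
  have hda : (pderiv 0 : Derivation k (MvPolynomial (Fin 3) k) _) (X 0 ^ 2 * X 2 ^ 2 + X 1 ^ 4 + 1) =
      2 * (X 0 * X 2 ^ 2) := by
    simp [Derivation.leibniz, Derivation.leibniz_pow]
    ring
  have hdb : (pderiv 1 : Derivation k (MvPolynomial (Fin 3) k) _) (X 0 ^ 2 * X 2 ^ 2 + X 1 ^ 4 + 1) =
      4 * X 1 ^ 3 := by
    simp [Derivation.leibniz, Derivation.leibniz_pow]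
  rw [hda] at ha
  rw [hdb] at hb
  have hac : X 0 * X 2 ^ 2 ∈ Q := mem_of_two_mul_mem hQ h2A ha
  have hb1 : X 1 ∈ Q := hQ.mem_of_pow_mem 3 (mem_of_four_mul_mem hQ h2A hb)
  have h1 : (1 : MvPolynomial (Fin 3) k) = (X 0 ^ 2 * X 2 ^ 2 + X 1 ^ 4 + 1) - X 0 * (X 0 * X 2 ^ 2) - X 1 * X 1 ^ 3 := by
    ring
  have : (1 : MvPolynomial (Fin 3) k) ∈ Q := by
    rw [h1]
    exact Q.sub_mem (Q.sub_mem hqQ (Q.mul_mem_left _ hac)) (Q.mul_mem_left _ (Q.pow_mem_of_mem hb1 3 (by norm_num)))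
  exact hQ.ne_top ((Ideal.eq_top_iff_one _).mpr this)

end SmoothCharts

end Summit.ResolutionOfSingularities.ResolutionOfSingularities.Theorems.EquisingularLift.SpecimenQuartic

end
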